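/-
Copyright (c) 2026. All rights reserved.
Released under Apache 2.0 license as described in the file LICENSE.
Authors: abc-iut cell, wave-3 discharge prover seat abc-iut-L6-d4 (supplement to abc-iut-L6-d5's record file).
-/
import Literature.IUT.LogThetaLattice.RealifiedSemisimplificationProofs
import Literature.IUT.LogThetaLattice.RealifiedSemisimplificationProofsB
import HarnessLib

/-!
# [IUTchIII] Remark 3.9.4 (iii)/(vi), companion C: ball-preserving injections preserve Haar measure,
# `μ(log_k(S)) = μ(S)` for every translation-invariant Borel measure finite on compacts, and the
# `ℂ`-instance of the corrected `Remark394vi_expPreservesVolume'`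

S. Mochizuki, *Inter-universal Teichmüller theory III*, kurims manuscript (May 2020) of PRIMS **57**
(2021), §3, Remark 3.9.4 (iii) pp. 122–123 (read on the page). PROOF-ONLY supplement (no definitions;
seat abc-iut-L6-d4, filed as `…ProofsC.lean` per abc-iut-L6-lead 20:06:06Z) to the RECORD discharge of
node IUTchIII:Rmk3.9.4(iii) by abc-iut-L6-d5, `Literature/IUT/LogThetaLattice/RealifiedSemisimplificationProofs.lean`
(p405808: `remark394iii_logPreservesVolume_unitLog` — `μ(log_p S) = μ(S)` for compact `S ⊆ 𝒪_K^×` with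
`log_p|_S` injective, every additive Haar measure `μ`, by thickening `S` to compact open sets and
passing to the limit). This file gives a second, direct route and two reusable by-products:

* §1 (Mathlib-only content) `measure_image_inter_closedBall_eq_of_ball_images`: in a proper ultrametric
  normed group, a map injective on a closed ball `B = closedBall x₀ r` that carries every closed
  sub-ball of `B` onto the closed ball of the same radius about the image point preserves EVERY
  translation-invariant Borel measure finite on compacts on ALL Borel subsets of `B` — the two finite
  measures `A ↦ μ(f(A ∩ B))`, `A ↦ μ(A ∩ B)` agree on the π-system of closed balls of radius `≤ r`, which
  generates the Borel σ-algebra (the technique of the tree's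
  `Literature.MeasureTheory.Group.PadicPolynomialChangeOfVariables`, here for an abstract `f`; this is
  the text's proof of [AbsTopIII] Prop. 5.7 (i)(c), p. 139, run for Borel instead of compact open sets).
* §2 `dist_unitLog_eq_dist`: abc-iut-S1's `log_p = unitLog` is an ISOMETRY on every closed ball of radius
  `≤ ‖p*‖` (`p* = p`, resp. `4`) about a unit — `‖L(u)‖ = ‖1 − u‖` (`norm_logSeries_eq_norm`, the equality
  case of the contraction estimate `norm_logSeries_add_le`) — hence injective there
  (`injOn_unitLog_closedBall`; abc-iut-L6-d5's `unitLog_injOn_closedBall_unit` is the radius-`p⁻²` form via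
  torsion fibres, abc-iut-L3-t11's `isIsometricOnSmallBalls_unitLog` the ball-image form).
* §3 `remark394iii_logPreservesVolume_of_isAddLeftInvariant`: the named fact
  `Remark394iii_logPreservesVolume (sphere 0 1) unitLog μ` for every `[μ.IsAddLeftInvariant]
  [IsFiniteMeasureOnCompacts μ]` (no regularity / positivity-on-opens assumed), by a finite disjoint
  cover of the compact `S` by such balls centred in `S` and §1 on each piece.
* §4 `Remark394vi_expPreservesVolume'_holds`: the `ℂ`-instance of abc-iut-L6-t4's CORRECTED typing
  `Remark394vi_expPreservesVolume'` (v2, compact `S`) of Remark 3.9.4 (vi) — node IUTchIII:Rmk3.9.4(vi)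
  DISCHARGED as re-typed — from companion B's `Remark394vi_expPreservesVolume_of_isCompact` (p406145).

Classical content (Koblitz GTM 58 IV §1–2; Haar measure); nothing here bears on [IUTchIII] Cor. 3.12;
the tag [claim: Mochizuki2012, status: disputed] on §3 records that its STATEMENT is the disputed
paper's sentence. Typed ≠ discharged elsewhere.
-/

set_option autoImplicit false

noncomputable section

open MeasureTheory MeasureTheory.Measure Set Metric TopologicalSpace
open scoped ENNReal NNReal Pointwise

namespace Literature.IUT.LogThetaLattice

/-! ## §1 Ultrametric measure theory: ball-preserving injections preserve Haar measure -/

section UltrametricHaar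

variable {K : Type*} [NormedAddCommGroup K] [IsUltrametricDist K]

/-- Closed balls of radius in `(0, r]`, together with `∅`, form a π-system in an ultrametric space
(two such balls are nested or disjoint); file-private helper. [folklore] -/
private theorem isPiSystem_closedBalls_le (r : ℝ) :
    IsPiSystem {S : Set K | S = ∅ ∨ ∃ y : K, ∃ s : ℝ, 0 < s ∧ s ≤ r ∧ S = closedBall y s} := by
  rintro S hS T hT hne
  rcases hS with rfl | ⟨y, s, hs0, hsr, rfl⟩
  · rw [empty_inter] at hne; exact absurd hne not_nonempty_empty
  rcases hT with rfl | ⟨y', s', hs0', hsr', rfl⟩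
  · rw [inter_empty] at hne; exact absurd hne not_nonempty_empty
  rcases IsUltrametricDist.closedBall_subset_trichotomy (x := y) (r := s) (y := y') (s := s') with
    h | h | h
  · exact Or.inr ⟨y, s, hs0, hsr, inter_eq_left.mpr h⟩
  · exact Or.inr ⟨y', s', hs0', hsr', inter_eq_right.mpr h⟩
  · rw [h.inter_eq] at hne; exact absurd hne not_nonempty_empty

variable [ProperSpace K]

/-- In a proper ultrametric normed group the closed balls of radius in `(0, r]` (and `∅`) form a basis
of the topology (closed balls of positive radius are open), hence generate the Borel σ-algebra;
file-private helper. [folklore] -/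
private theorem borel_eq_generateFrom_closedBalls_le {r : ℝ} (hr : 0 < r) :
    borel K = MeasurableSpace.generateFrom
      {S : Set K | S = ∅ ∨ ∃ y : K, ∃ s : ℝ, 0 < s ∧ s ≤ r ∧ S = closedBall y s} := by
  apply IsTopologicalBasis.borel_eq_generateFrom
  apply isTopologicalBasis_of_isOpen_of_nhds
  · rintro S (rfl | ⟨y, s, hs0, -, rfl⟩)
    · exact isOpen_empty
    · exact IsUltrametricDist.isOpen_closedBall (x := y) hs0.ne'
  · intro a U haU hU
    obtain ⟨ε, hε, hball⟩ := Metric.isOpen_iff.mp hU a haU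
    have hm : 0 < min (ε / 2) r := lt_min (half_pos hε) hr
    refine ⟨closedBall a (min (ε / 2) r), Or.inr ⟨a, _, hm, min_le_right _ _, rfl⟩,
      mem_closedBall_self hm.le, ?_⟩
    exact (closedBall_subset_ball (lt_of_le_of_lt (min_le_left _ _) (half_lt_self hε))).trans hball

omit [IsUltrametricDist K] [ProperSpace K] in
/-- A map that carries every closed sub-ball (of positive radius) of `B = closedBall x₀ r` onto the
closed ball of the same radius about the image point is continuous on `B` (indeed `1`-Lipschitz);
file-private helper. [folklore] -/
private theorem continuousOn_of_ball_images {f : K → K} {x₀ : K} {r : ℝ} (hr : 0 < r)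
    (hball : ∀ y ∈ closedBall x₀ r, ∀ s : ℝ, 0 < s → s ≤ r →
      f '' closedBall y s = closedBall (f y) s) :
    ContinuousOn f (closedBall x₀ r) := by
  rw [Metric.continuousOn_iff]
  intro y hy ε hε
  refine ⟨min ε r, lt_min hε hr, fun z hz hdist => ?_⟩
  rcases eq_or_ne (dist z y) 0 with h0 | h0
  · rw [dist_eq_zero.mp h0, dist_self]; exact hε
  have hpos : 0 < dist z y := lt_of_le_of_ne dist_nonneg (Ne.symm h0)
  have hle : dist z y ≤ r := (lt_min_iff.mp hdist).2.le
  have hfz : f z ∈ closedBall (f y) (dist z y) := by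
    rw [← hball y hy (dist z y) hpos hle]
    exact mem_image_of_mem f (mem_closedBall.mpr le_rfl)
  exact lt_of_le_of_lt (mem_closedBall.mp hfz) (lt_min_iff.mp hdist).1

variable [MeasurableSpace K] [BorelSpace K]

/-- **Ball-preserving injections preserve Haar measure (ultrametric).** Let `μ` be a translation
invariant Borel measure on the proper ultrametric normed group `K`, finite on compacts; let
`B = closedBall x₀ r` (`r > 0`) and `f : K → K` be injective on `B` and such that
`f(closedBall y s) = closedBall (f y) s` for all `y ∈ B`, `0 < s ≤ r`. Then `μ(f(A ∩ B)) = μ(A ∩ B)` for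
every Borel `A`: the two sides are finite measures in `A` that agree on the π-system of closed balls of
radius `≤ r` (nested-or-disjoint with `B`; inside `B` both are the measure of a ball of the same radius,
by translation invariance), which generates the Borel σ-algebra. This is the argument of the text's
proof of [AbsTopIII] Prop. 5.7 (i)(c) ("`log_k` determines a bijection `x + 𝔪_k^n ≅ log_k(x) + 𝔪_k^n`",
p. 139), run for Borel instead of compact open sets.
[cite: MochizukiAbsTopIII2015, Prop 5.7 (i)(c) p. 138, proof p. 139] -/
theorem measure_image_inter_closedBall_eq_of_ball_images (μ : Measure K) [μ.IsAddLeftInvariant]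
    [IsFiniteMeasureOnCompacts μ] {f : K → K} {x₀ : K} {r : ℝ} (hr : 0 < r)
    (hinj : InjOn f (closedBall x₀ r))
    (hball : ∀ y ∈ closedBall x₀ r, ∀ s : ℝ, 0 < s → s ≤ r →
      f '' closedBall y s = closedBall (f y) s)
    {A : Set K} (hA : MeasurableSet A) :
    μ (f '' (A ∩ closedBall x₀ r)) = μ (A ∩ closedBall x₀ r) := by
  set B := closedBall x₀ r with hB
  have hcont : ContinuousOn f B := continuousOn_of_ball_images hr hball
  -- `f|_B` is a closed embedding of the compact ball
  haveI : CompactSpace B := isCompact_iff_compactSpace.mp (isCompact_closedBall x₀ r)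
  let e : B → K := fun z ↦ f z
  have he_cont : Continuous e := hcont.comp_continuous continuous_subtype_val fun z ↦ z.2
  have he_inj : Function.Injective e := fun z w h ↦ Subtype.ext (hinj z.2 w.2 h)
  have hemb : MeasurableEmbedding e := (he_cont.isClosedEmbedding he_inj).measurableEmbedding
  -- the two measures in `A`
  set μ₁ : Measure K := (Measure.comap e μ).map Subtype.val with hμ₁
  set μ₂ : Measure K := μ.restrict B with hμ₂
  have hμ₁_apply : ∀ {S : Set K}, MeasurableSet S → μ₁ S = μ (f '' (S ∩ B)) := by
    intro S hS
    rw [hμ₁, Measure.map_apply measurable_subtype_coe hS, hemb.comap_apply,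
      show e = f ∘ Subtype.val from rfl, image_comp, Subtype.image_preimage_coe, inter_comm]
  have hμ₂_apply : ∀ {S : Set K}, MeasurableSet S → μ₂ S = μ (S ∩ B) := by
    intro S hS
    rw [hμ₂, Measure.restrict_apply hS]
  -- balls of radius `≤ r` inside `B` have images of the same measure
  have hballμ : ∀ (y : K) (s : ℝ), 0 < s → s ≤ r → closedBall y s ⊆ B →
      μ (f '' closedBall y s) = μ (closedBall y s) := by
    intro y s hs hsr hsub
    have hyB : y ∈ B := hsub (mem_closedBall_self hs.le)
    rw [hball y hyB s hs hsr, ← vadd_closedBall_zero s (f y), ← vadd_closedBall_zero s y,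
      measure_vadd, measure_vadd]
  -- the measures agree
  have hgen := (BorelSpace.measurable_eq (α := K)).trans (borel_eq_generateFrom_closedBalls_le (K := K) hr)
  haveI : IsFiniteMeasure μ₁ := ⟨by
    rw [hμ₁_apply MeasurableSet.univ, univ_inter]
    exact ((isCompact_closedBall x₀ r).image_of_continuousOn hcont).measure_lt_top⟩
  have hμ : μ₁ = μ₂ := by
    refine ext_of_generate_finite _ hgen (isPiSystem_closedBalls_le r) ?_ ?_
    · rintro S (rfl | ⟨y, s, hs0, hsr, rfl⟩)
      · simp
      · rw [hμ₁_apply measurableSet_closedBall, hμ₂_apply measurableSet_closedBall]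
        rcases IsUltrametricDist.closedBall_subset_trichotomy (x := y) (r := s) (y := x₀) (s := r)
          with h | h | h
        · rw [inter_eq_left.mpr h, hballμ y s hs0 hsr h]
        · rw [inter_eq_right.mpr h, hballμ x₀ r hr le_rfl subset_rfl]
        · rw [h.inter_eq, image_empty, measure_empty]
    · rw [hμ₁_apply MeasurableSet.univ, hμ₂_apply MeasurableSet.univ, univ_inter,
        hballμ x₀ r hr le_rfl subset_rfl]
  have hAe : μ₁ A = μ₂ A := by rw [hμ]
  rwa [hμ₁_apply hA, hμ₂_apply hA] at hAe

end UltrametricHaar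

/-! ## §2 The `p`-adic logarithm is an isometry on balls of radius `≤ ‖p*‖` about units -/

section UnitLogIsometry

open Literature.IUT.LogVolume Literature.AnabelianGeometry.AbsoluteAnabelian

variable (p : ℕ) [hp : Fact p.Prime]
variable {K : Type*} [NontriviallyNormedField K] [instK : NormedAlgebra ℚ_[p] K]
  [IsUltrametricDist K] [CompleteSpace K]
include instK

/-- **`‖L(y)‖ = ‖1 − y‖`** for the logarithmic series `L` when `‖1 − y‖ ≤ ρ` with contraction constant
`θ = ρ·p^{1/(p−1)} < 1`: by `‖L(y) + (1 − y)‖ ≤ θ‖1 − y‖ < ‖1 − y‖` (abc-iut-S1's `norm_logSeries_add_le`)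
and the ultrametric equality case. [cite: Koblitz1984, Ch. IV §1] -/
theorem norm_logSeries_eq_norm {ρ : ℝ} (hθ : ρ * (p : ℝ) ^ (1 / ((p : ℝ) - 1)) < 1) {y : K}
    (hy : ‖1 - y‖ ≤ ρ) : ‖logSeries y‖ = ‖1 - y‖ := by
  rcases eq_or_ne (1 - y) 0 with h0 | h0
  · have hy1 : y = 1 := (sub_eq_zero.mp h0).symm
    rw [hy1, logSeries_one, sub_self]
  have hpos : 0 < ‖1 - y‖ := norm_pos_iff.mpr h0
  have hlt : ‖logSeries y + (1 - y)‖ < ‖1 - y‖ := by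
    calc ‖logSeries y + (1 - y)‖ ≤ ρ * (p : ℝ) ^ (1 / ((p : ℝ) - 1)) * ‖1 - y‖ :=
          norm_logSeries_add_le p K hθ.le hy
      _ < 1 * ‖1 - y‖ := by gcongr
      _ = ‖1 - y‖ := one_mul _
  have hne : ‖logSeries y + (1 - y)‖ ≠ ‖-(1 - y)‖ := by rw [norm_neg]; exact hlt.ne
  calc ‖logSeries y‖ = ‖(logSeries y + (1 - y)) + (-(1 - y))‖ := by rw [add_neg_cancel_right]
    _ = max ‖logSeries y + (1 - y)‖ ‖-(1 - y)‖ :=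
        IsUltrametricDist.norm_add_eq_max_of_norm_ne_norm hne
    _ = ‖1 - y‖ := by rw [norm_neg, max_eq_right hlt.le]

variable [ProperSpace K]

omit [CompleteSpace K] in
/-- **Isometry of `log_p` on small balls about units**: for a unit `x`, `r ≤ ‖p*‖` (`p* = p`, resp. `4`)
and `y, z ∈ closedBall x r`, `dist (log_p y) (log_p z) = dist y z` — since `log_p z − log_p y = L(y⁻¹z)`
and `‖L(u)‖ = ‖1 − u‖ = ‖y − z‖`. (The text's "`log_k` determines a bijection
`x + 𝔪_k^n ≅ log_k(x) + 𝔪_k^n`", [AbsTopIII] Prop. 5.7 (i) proof p. 139, in metric form.)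
[cite: MochizukiAbsTopIII2015, Prop 5.7 (i)(c) p. 138] -/
theorem dist_unitLog_eq_dist {x : K} (hx : ‖x‖ = 1) {r : ℝ}
    (hr : r ≤ ‖((p ^ (if p = 2 then 2 else 1) : ℕ) : K)‖) {y z : K}
    (hy : y ∈ closedBall x r) (hz : z ∈ closedBall x r) :
    dist (unitLog y) (unitLog z) = dist y z := by
  have hθ := mul_rpow_lt_one_of_le_norm_pstarPow p hr
  -- `r < 1`
  have hp1 : (1 : ℝ) ≤ p := by exact_mod_cast (Fact.out : p.Prime).one_lt.le
  have hq : 1 ≤ (p : ℝ) ^ (1 / ((p : ℝ) - 1)) :=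
    Real.one_le_rpow hp1 (div_nonneg zero_le_one (by linarith))
  have hr0 : 0 ≤ r := dist_nonneg.trans (mem_closedBall.mp hy)
  have hr1 : r < 1 := by
    calc r = r * 1 := (mul_one r).symm
      _ ≤ r * (p : ℝ) ^ (1 / ((p : ℝ) - 1)) := by gcongr
      _ < 1 := hθ
  have hy1 : ‖y‖ = 1 := norm_eq_one_of_mem_closedBall_unit hx hr1 hy
  have hz1 : ‖z‖ = 1 := norm_eq_one_of_mem_closedBall_unit hx hr1 hz
  have hy0 : y ≠ 0 := norm_pos_iff.mp (by rw [hy1]; exact one_pos)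
  -- `u := y⁻¹ z` has `‖1 - u‖ = dist y z ≤ r`
  have hyz : dist y z ≤ r := by
    have h := dist_triangle_max y x z
    rw [dist_comm x z] at h
    exact h.trans (max_le (mem_closedBall.mp hy) (mem_closedBall.mp hz))
  have hu : ‖1 - y⁻¹ * z‖ = dist y z := by
    rw [show (1 : K) - y⁻¹ * z = y⁻¹ * (y - z) by field_simp, norm_mul, norm_inv, hy1, inv_one,
      one_mul, dist_eq_norm]
  have huP : IsPrincipal (y⁻¹ * z) := by
    show ‖1 - y⁻¹ * z‖ < 1
    rw [hu]; exact hyz.trans_lt hr1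
  have hz' : z = y * (y⁻¹ * z) := by field_simp
  rw [dist_eq_norm (unitLog y), hz', unitLog_mul p hy1 huP.norm_eq_one, ← hz',
    unitLog_of_isPrincipal p huP, sub_add_cancel_left, norm_neg,
    norm_logSeries_eq_norm p hθ (hu.le.trans hyz), hu]

omit [CompleteSpace K] in
/-- Hence `log_p` is injective on every closed ball of radius `≤ ‖p*‖` about a unit.
[cite: MochizukiAbsTopIII2015, Prop 5.7 (i)(c) p. 138] -/
theorem injOn_unitLog_closedBall {x : K} (hx : ‖x‖ = 1) {r : ℝ}
    (hr : r ≤ ‖((p ^ (if p = 2 then 2 else 1) : ℕ) : K)‖) :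
    InjOn (unitLog : K → K) (closedBall x r) := by
  intro y hy z hz h
  have hd := dist_unitLog_eq_dist p hx hr hy hz
  rw [h, dist_self] at hd
  exact dist_eq_zero.mp hd.symm

end UnitLogIsometry

/-! ## §3 Remark 3.9.4 (iii) for every left-invariant Borel measure finite on compacts -/

section Rmk394iii

open Literature.IUT.LogVolume Literature.AnabelianGeometry.AbsoluteAnabelian

variable (p : ℕ) [hp : Fact p.Prime]
variable (K : Type*) [NontriviallyNormedField K] [instK : NormedAlgebra ℚ_[p] K]
  [IsUltrametricDist K] [ProperSpace K] [MeasurableSpace K] [BorelSpace K]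
include instK

/-- **IUTchIII:Rmk3.9.4(iii) for every translation-invariant Borel measure finite on compacts**
(record discharge: abc-iut-L6-d5's `remark394iii_logPreservesVolume_unitLog`, Haar measures; kurims p. 122: "for any compact ample subset `S ⊆ 𝒪^×_k` on which `log_k : 𝒪^×_k → k` is
injective, we have `μ_k(S) = μ_k(log_k(S))` [cf. [AbsTopIII], Proposition 5.7, (i), (c)]"): at
`U := 𝒪_K^× = sphere 0 1`, `logk := log_p = unitLog`, `vol := μ`. Direct proof: cover the compact `S` by finitely
many pairwise disjoint closed balls of radius `r := min(r₀, ‖p*‖)` centred in `S` (`r₀` from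
abc-iut-L3-t11's `isIsometricOnSmallBalls_unitLog`); on each ball `log_p` is injective
(`injOn_unitLog_closedBall`) and ball-preserving, so `measure_image_inter_closedBall_eq_of_ball_images`
gives `μ(log_p(S ∩ B)) = μ(S ∩ B)`; the images of the pieces are pairwise disjoint by the injectivity of
`log_p` on `S`. [claim: Mochizuki2012, status: disputed] -/
theorem remark394iii_logPreservesVolume_of_isAddLeftInvariant (μ : Measure K)
    [μ.IsAddLeftInvariant] [IsFiniteMeasureOnCompacts μ] :
    Remark394iii_logPreservesVolume (sphere (0 : K) 1) (unitLog : K → K) (fun A => μ A) := by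
  intro S hSU hSc _hpos hinj
  obtain ⟨r₀, hr₀, hballs⟩ := isIsometricOnSmallBalls_unitLog p (K := K)
  set ps : ℝ := ‖((p ^ (if p = 2 then 2 else 1) : ℕ) : K)‖ with hps
  have hps0 : 0 < ps := norm_pos_iff.mpr (pstarPow_cast_ne_zero p K)
  set r : ℝ := min r₀ ps with hrdef
  have hr : 0 < r := lt_min hr₀ hps0
  have hrr₀ : r ≤ r₀ := min_le_left _ _
  have hrps : r ≤ ps := min_le_right _ _
  have hr1 : r < 1 := by
    have hθ := mul_rpow_lt_one_of_le_norm_pstarPow p hrps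
    have hp1 : (1 : ℝ) ≤ p := by exact_mod_cast (Fact.out : p.Prime).one_lt.le
    have hq : 1 ≤ (p : ℝ) ^ (1 / ((p : ℝ) - 1)) :=
      Real.one_le_rpow hp1 (div_nonneg zero_le_one (by linarith))
    calc r = r * 1 := (mul_one r).symm
      _ ≤ r * (p : ℝ) ^ (1 / ((p : ℝ) - 1)) := by gcongr
      _ < 1 := hθ
  have hSunit : ∀ x ∈ S, ‖x‖ = 1 := fun x hx => mem_sphere_zero_iff_norm.mp (hSU hx)
  -- the key identity on one ball centred at a point of `S`
  have key : ∀ x ∈ S, μ (unitLog '' (S ∩ closedBall x r)) = μ (S ∩ closedBall x r) := by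
    intro x hx
    refine measure_image_inter_closedBall_eq_of_ball_images μ hr
      (injOn_unitLog_closedBall p (hSunit x hx) hrps) (fun y hy s hs hsr => ?_)
      hSc.isClosed.measurableSet
    exact hballs y (norm_eq_one_of_mem_closedBall_unit (hSunit x hx) hr1 hy) s hs (hsr.trans hrr₀)
  -- a finite cover of `S` by balls of radius `r` centred in `S`
  obtain ⟨t, ht⟩ := hSc.elim_finite_subcover (fun x : S => closedBall (x : K) r)
    (fun x => IsUltrametricDist.isOpen_closedBall (x := (x : K)) hr.ne')
    (fun x hx => mem_iUnion.mpr ⟨⟨x, hx⟩, mem_closedBall_self hr.le⟩)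
  classical
  set D : Finset (Set K) := t.image fun x : S => closedBall (x : K) r with hD
  have hDmem : ∀ B ∈ D, ∃ x ∈ S, B = closedBall x r := by
    intro B hB
    obtain ⟨x, -, rfl⟩ := Finset.mem_image.mp hB
    exact ⟨(x : K), x.2, rfl⟩
  -- distinct balls of the same radius are disjoint
  have hDdisj : ∀ B₁ ∈ D, ∀ B₂ ∈ D, B₁ ≠ B₂ → Disjoint B₁ B₂ := by
    intro B₁ hB₁ B₂ hB₂ hne
    obtain ⟨x₁, -, rfl⟩ := hDmem B₁ hB₁
    obtain ⟨x₂, -, rfl⟩ := hDmem B₂ hB₂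
    exact (IsUltrametricDist.closedBall_eq_or_disjoint (x := x₁) (y := x₂) (r := r)).resolve_left hne
  have hSeq : S = ⋃ B ∈ D, S ∩ B := by
    apply Subset.antisymm
    · intro y hy
      obtain ⟨x, hxt, hyx⟩ : ∃ x ∈ t, y ∈ closedBall (x : K) r := by
        simpa only [mem_iUnion, exists_prop] using ht hy
      exact mem_iUnion₂.mpr ⟨closedBall (x : K) r, Finset.mem_image_of_mem _ hxt, hy, hyx⟩
    · exact iUnion₂_subset fun B _ => inter_subset_left
  have hdisj₁ : Set.PairwiseDisjoint (↑D : Set (Set K)) (fun B => unitLog '' (S ∩ B)) := by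
    intro B₁ hB₁ B₂ hB₂ hne
    refine Set.disjoint_image_image fun a ha b hb hab => ?_
    have hab' : a = b := hinj ha.1 hb.1 hab
    subst hab'
    exact Set.disjoint_left.mp (hDdisj B₁ hB₁ B₂ hB₂ hne) ha.2 hb.2
  have hdisj₂ : Set.PairwiseDisjoint (↑D : Set (Set K)) (fun B => S ∩ B) := by
    intro B₁ hB₁ B₂ hB₂ hne
    exact (hDdisj B₁ hB₁ B₂ hB₂ hne).mono inter_subset_right inter_subset_right
  have hmeas₁ : ∀ B ∈ D, MeasurableSet (unitLog '' (S ∩ B)) := by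
    intro B hB
    obtain ⟨x, hx, rfl⟩ := hDmem B hB
    have hcont : ContinuousOn (unitLog : K → K) (closedBall x r) :=
      continuousOn_of_ball_images hr fun y hy s hs hsr =>
        hballs y (norm_eq_one_of_mem_closedBall_unit (hSunit x hx) hr1 hy) s hs (hsr.trans hrr₀)
    exact ((hSc.inter_right isClosed_closedBall).image_of_continuousOn
      (hcont.mono inter_subset_right)).isClosed.measurableSet
  have hmeas₂ : ∀ B ∈ D, MeasurableSet (S ∩ B) := by
    intro B hB
    obtain ⟨x, -, rfl⟩ := hDmem B hB
    exact (hSc.isClosed.inter isClosed_closedBall).measurableSet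
  show μ (unitLog '' S) = μ S
  rw [hSeq, image_iUnion₂, measure_biUnion_finset hdisj₁ hmeas₁, measure_biUnion_finset hdisj₂ hmeas₂]
  refine Finset.sum_congr rfl fun B hB => ?_
  obtain ⟨x, hx, rfl⟩ := hDmem B hB
  exact key x hx


end Rmk394iii


/-! ## §4 Remark 3.9.4 (vi), corrected form: the `ℂ`-instance of `Remark394vi_expPreservesVolume'` -/

section Rmk394vi

open Complex Literature.AnabelianGeometry.AbsoluteAnabelian

/-- **IUTchIII:Rmk3.9.4(vi), DISCHARGED in the corrected (compact) typing** of abc-iut-L6-t4's v2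
(`Remark394vi_expPreservesVolume'`, appended after this seat's finding; kurims pp. 125–126): at
`k = ℂ`, `L := log_k(𝒪^×_k) = iℝ`, `expk := exp`, `volAng := μ̆_k` (abc-iut-L4-t3's angular volume
`ComplexVolume.angularVolume`, [AbsTopIII] Prop. 5.7 (ii)(a), as an extended real) and `volLin :=` Lebesgue
measure along `iℝ` (of the `im`-projection): for every compact `S ⊆ iℝ` on which `exp` is injective,
`μ̆_k(exp(S)) = volLin(S)` — from `Remark394vi_expPreservesVolume_of_isCompact` (companion B, p406145) and
the finiteness of the Lebesgue measure of the compact `im(S)`. [claim: Mochizuki2012, status: disputed] -/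
theorem Remark394vi_expPreservesVolume'_holds :
    Remark394vi_expPreservesVolume' {z : ℂ | z.re = 0} exp
      (fun A => ENNReal.ofReal (ComplexVolume.angularVolume A)) (fun S => volume (Complex.im '' S)) := by
  intro S hSL hSc hinj
  show ENNReal.ofReal (ComplexVolume.angularVolume (exp '' S)) = volume (Complex.im '' S)
  rw [Remark394vi_expPreservesVolume_of_isCompact hSL hSc hinj,
    ENNReal.ofReal_toReal (hSc.image Complex.continuous_im).measure_lt_top.ne]

end Rmk394vi

end Literature.IUT.LogThetaLattice

end
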